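import Summits.FinalStateConjecture.FinalStateConjecture.Theses.BartnikGapSettling
import Summits.FinalStateConjecture.FinalStateConjecture.Theorems.BartnikGapSettlingBondiBartnikRigidityTrivialRegime
import Literature.Geometry.Lorentzian.BondiBartnikGap
import Literature.Geometry.Lorentzian.CausalFutureProofs

/-!
# Port certificate for line `hyperboloidal-mass-pinches-flat` (crux `BondiBartnikRigidity`, stmt-FinalStateConjecture-10807)

Mechanical check of the claim made in `Lines/hyperboloidal-mass-pinches-flat.lean` / `.md`: the REPAIRED crux C″ of lead c1
(`Lines/SketchRepairedStatement.lean`, `BondiBartnikRigidityRepaired`: `Λ < 1`, `N ≤ 1`, `N = 0 ∨ p ∈ collar`) follows by pure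
logic from the line's four GENUINE stubs (B1 `stub_probeBartnikMassZero`, F3 `stub_escapeWindowLeaf`, B2
`stub_hyperboloidalMassPinchesFlat`, foreign `stub_collarSectorGap`) and the landed trivial regime — i.e. WITHOUT the flagged
`stub_filedTextResidue`.  So a restatement of the crux to C″ ports the line by deleting exactly that stub.  The four stub
statements appear here as HYPOTHESES (copied verbatim from the skeleton); `BondiBartnikRigidityRepaired` is copied verbatim from
c1's file (crux workfiles are not importable modules).  Sorry-free.
-/

noncomputable section

-- D-0017: single-problem summit, `Summit.<S>.<S>.…` by design (cf. lakefile `weak.linter.dupNamespace`).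
set_option linter.dupNamespace false

open Set Filter Function Topology TopologicalSpace
open Literature.Geometry.Lorentzian
open scoped Manifold ContDiff Topology ENNReal BigOperators

namespace Summit.FinalStateConjecture.FinalStateConjecture.Cruxes.BondiBartnikRigidity.HyperboloidalMassPinchesFlat.Port

/-- **Repaired crux C″** — verbatim `BondiBartnikRigidityRepaired` of `Lines/SketchRepairedStatement.lean` (lead c1,
2026-08-16): the filed statement with `Λ < 1`, `N ≤ 1`, and `p` in a collar slab when `N = 1`. -/
def BondiBartnikRigidityRepaired : Prop :=
  open Literature.Geometry.Lorentzian in ∀ (χ m₀ : ℝ) (N₀ k : ℕ) (ε : ENNReal), χ < 1 → 0 < m₀ → 0 < ε → ∃ k' : ℕ, ∀ Λ : ENNReal, Λ < 1 → ∃ (δ : ENNReal) (γ : ℝ), 0 < δ ∧ 0 < γ ∧ ∀ (X : Type) [TopologicalSpace X] [ChartedSpace E3 X] [IsManifold (𝓡 3) ((⊤ : ℕ∞) : WithTop ℕ∞) X] [T2Space X] [SecondCountableTopology X] [ConnectedSpace X], ∀ D ∈ admissibleVacuumData X, ∀ (𝒟 : VacuumCauchyDevelopment D) (N : ℕ) (M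 a : Fin N → ℝ) (S : Set 𝒟.carrier) (p : 𝒟.carrier) (mo' : Fin N → lorentzGroup × E4) (B' : Fin N → ModelBackground) (Φ : ∀ i, (B' i).domain → 𝒟.carrier), 𝒟.IsMaximal → N ≤ N₀ → N ≤ 1 → (∀ i, m₀ ≤ M i ∧ M i ≤ m₀⁻¹ ∧ |a i| ≤ χ * M i) → 𝒟.toCauchyDevelopment.IsNearKerrLeaf k' Λ N M a S → p ∈ S → (N = 0 ∨ ∃ i, p ∈ Φ i '' (B' i).truncTimeSlab (3 * M i) 0) → (∀ i, B' i = starBackground (mo' i).1 (mo' i).2 (M i) (a i) (fun x => Kerr.radius (a i) (poincareInv (mo' i).1 (mo' i).2 x))) → (∀ i, ContMDiffOn 𝓘(ℝ, E4) (𝓡 4) ((⊤ : ℕ∞) : WithTop ℕ∞) (Φ i) {x | -1 < (B' i).time x.1 ∧ (B' i).time x.1 < 1 ∧ (B' i).radius x.1 < 3 * M i + 1} ∧ Topology.IsOpenEmbedding ({x | -1 < (B' i).time x.1 ∧ (B' i).time x.1 < 1 ∧ (B' i).radius x.1 < 3 * M i + 1}.restrict (Φ i))) → (∀ i, 𝒟.toSpacetime.truncDeviationCk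 (B' i) (Φ i) k' (3 * M i) 0 ≤ δ) → (∀ i, Φ i '' (B' i).truncTimeSlab (3 * M i) 0 ⊆ S) → Pairwise (Function.onFun Disjoint fun i => Φ i '' (B' i).truncTimeSlab (3 * M i) 0) → (∃ m : ℝ, 𝒟.toCauchyDevelopment.HasCutBondiMass ({p} ∪ ⋃ i, Φ i '' (B' i).truncTimeSlab (3 * M i) 0) m) → (∀ (X' : Type) [TopologicalSpace X'] [ChartedSpace E3 X'] [IsManifold (𝓡 3) ((⊤ : ℕ∞) : WithTop ℕ∞) X'] [T2Space X'] [SecondCountableTopology X'] [ConnectedSpace X'], ∀ D' ∈ admissibleVacuumData X', ∀ (𝒟' : VacuumCauchyDevelopment D') (U : Set 𝒟.carrier) (φ : 𝒟.carrier → 𝒟'.carrier) (m' : ℝ), 𝒟'.IsMaximal → IsOpen U → ({p} ∪ ⋃ i, Φ i '' (B' i).truncTimeSlab (3 * M i) 0) ⊆ U → ContMDiffOn (𝓡 4) (𝓡 4) ((⊤ : ℕ∞) : WithTop ℕ∞) φ U → Topology.IsOpenEmbedding (U.restrict φ) → (∀ q ∈ U, pullbackBilin (I := 𝓡 4) (I'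 := 𝓡 4) φ 𝒟'.metric.val q = 𝒟.metric.val q) → (∀ q ∈ U, 𝒟'.timeOrientation.IsFutureDirected (mfderiv (𝓡 4) (𝓡 4) φ q (𝒟.timeOrientation.vectorField q))) → 𝒟'.toCauchyDevelopment.HasCutBondiMass (φ '' ({p} ∪ ⋃ i, Φ i '' (B' i).truncTimeSlab (3 * M i) 0)) m' → ∀ η : ℝ, 0 < η → ∃ m : ℝ, 𝒟.toCauchyDevelopment.HasCutBondiMass ({p} ∪ ⋃ i, Φ i '' (B' i).truncTimeSlab (3 * M i) 0) m ∧ m ≤ m' + γ + η) → ∃ S' : Set 𝒟.carrier, 𝒟.toCauchyDevelopment.IsNearKerrLeaf k ε N M a S' ∧ S' ⊆ 𝒟.metric.causalFuture 𝒟.timeOrientation S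

/-- **C″ from the line's genuine stubs** (no filed-text residue): trivial regime `Λ ≤ ε` (landed p103152); `ε < Λ < 1`:
`N = 0` by B1 → F3 → B2 and `J⁺(S₁) ⊆ J⁺(J⁺{p}) = J⁺{p} ⊆ J⁺(S)`; `N = 1` (then `p` is in the collar by the C″ clause) by the
foreign collar stub; `N ≥ 2` is excluded by `N ≤ 1`. -/
theorem repaired_of_lineStubs
    (hB1 : ∀ (X : Type) [TopologicalSpace X] [ChartedSpace E3 X] [IsManifold (𝓡 3) ∞ X]
      [T2Space X] [SecondCountableTopology X] [ConnectedSpace X],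
      ∀ D ∈ admissibleVacuumData X, ∀ (𝒟 : VacuumCauchyDevelopment D) (p : 𝒟.carrier),
      𝒟.IsMaximal → p ∈ 𝒟.metric.causalFuture 𝒟.timeOrientation (range 𝒟.embed) →
      ∀ η : ℝ, 0 < η → ∃ m' : ℝ, 𝒟.IsCompetitorMass ({p} : Set 𝒟.carrier) m' ∧ m' ≤ η)
    (hF3 : ∀ (k₁ : ℕ), ∃ k' : ℕ, ∀ Λ : ℝ≥0∞, Λ < 1 →
      ∃ (Λ₁ : ℝ≥0∞) (γ : ℝ), Λ₁ < 1 ∧ 0 < γ ∧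
      ∀ (X : Type) [TopologicalSpace X] [ChartedSpace E3 X] [IsManifold (𝓡 3) ∞ X]
      [T2Space X] [SecondCountableTopology X] [ConnectedSpace X],
      ∀ D ∈ admissibleVacuumData X, ∀ (𝒟 : VacuumCauchyDevelopment D) (M a : Fin 0 → ℝ)
      (S : Set 𝒟.carrier) (p : 𝒟.carrier) (m : ℝ),
      𝒟.IsMaximal → 𝒟.toCauchyDevelopment.IsNearKerrLeaf k' Λ 0 M a S → p ∈ S →
      𝒟.toCauchyDevelopment.HasCutBondiMass ({p} : Set 𝒟.carrier) m → m ≤ γ →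
      ∃ S₁ : Set 𝒟.carrier, 𝒟.toCauchyDevelopment.IsNearKerrLeaf k₁ Λ₁ 0 M a S₁ ∧
      S₁ ⊆ 𝒟.metric.causalFuture 𝒟.timeOrientation ({p} : Set 𝒟.carrier))
    (hB2 : ∀ (k : ℕ) (ε : ℝ≥0∞), 0 < ε → ∃ k₁ : ℕ,
      ∀ Λ₁ : ℝ≥0∞, Λ₁ < 1 → ∃ γ : ℝ, 0 < γ ∧
      ∀ (X : Type) [TopologicalSpace X] [ChartedSpace E3 X] [IsManifold (𝓡 3) ∞ X]
      [T2Space X] [SecondCountableTopology X] [ConnectedSpace X],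
      ∀ D ∈ admissibleVacuumData X, ∀ (𝒟 : VacuumCauchyDevelopment D) (M a : Fin 0 → ℝ)
      (S₁ : Set 𝒟.carrier) (p : 𝒟.carrier) (m : ℝ),
      𝒟.IsMaximal → 𝒟.toCauchyDevelopment.IsNearKerrLeaf k₁ Λ₁ 0 M a S₁ →
      S₁ ⊆ 𝒟.metric.causalFuture 𝒟.timeOrientation ({p} : Set 𝒟.carrier) →
      𝒟.toCauchyDevelopment.HasCutBondiMass ({p} : Set 𝒟.carrier) m → m ≤ γ →
      ∃ S' : Set 𝒟.carrier, 𝒟.toCauchyDevelopment.IsNearKerrLeaf k ε 0 M a S' ∧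
      S' ⊆ 𝒟.metric.causalFuture 𝒟.timeOrientation S₁)
    (hCo : ∀ (χ m₀ : ℝ) (k : ℕ) (ε : ℝ≥0∞), χ < 1 → 0 < m₀ → 0 < ε →
      ∃ k' : ℕ, ∀ Λ : ℝ≥0∞, Λ < 1 → ε < Λ → ∃ (δ : ℝ≥0∞) (γ : ℝ), 0 < δ ∧ 0 < γ ∧
      ∀ (X : Type) [TopologicalSpace X] [ChartedSpace E3 X] [IsManifold (𝓡 3) ∞ X]
      [T2Space X] [SecondCountableTopology X] [ConnectedSpace X],
      ∀ D ∈ admissibleVacuumData X, ∀ (𝒟 : VacuumCauchyDevelopment D)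
      (M a : Fin 1 → ℝ) (S : Set 𝒟.carrier) (p : 𝒟.carrier) (mo' : Fin 1 → lorentzGroup × E4)
      (B' : Fin 1 → ModelBackground) (Φ : ∀ i, (B' i).domain → 𝒟.carrier),
      𝒟.IsMaximal → (∀ i, m₀ ≤ M i ∧ M i ≤ m₀⁻¹ ∧ |a i| ≤ χ * M i) →
      𝒟.toCauchyDevelopment.IsNearKerrLeaf k' Λ 1 M a S → p ∈ S →
      (∃ i, p ∈ Φ i '' (B' i).truncTimeSlab (3 * M i) 0) →
      (∀ i, B' i = starBackground (mo' i).1 (mo' i).2 (M i) (a i)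
      (fun x => Kerr.radius (a i) (poincareInv (mo' i).1 (mo' i).2 x))) →
      (∀ i, ContMDiffOn 𝓘(ℝ, E4) (𝓡 4) ∞ (Φ i)
      {x | -1 < (B' i).time x.1 ∧ (B' i).time x.1 < 1 ∧ (B' i).radius x.1 < 3 * M i + 1} ∧
      Topology.IsOpenEmbedding ({x | -1 < (B' i).time x.1 ∧ (B' i).time x.1 < 1 ∧
      (B' i).radius x.1 < 3 * M i + 1}.restrict (Φ i))) →
      (∀ i, 𝒟.toSpacetime.truncDeviationCk (B' i) (Φ i) k' (3 * M i) 0 ≤ δ) →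
      (∀ i, Φ i '' (B' i).truncTimeSlab (3 * M i) 0 ⊆ S) →
      (∃ m : ℝ, 𝒟.toCauchyDevelopment.HasCutBondiMass
      ({p} ∪ ⋃ i, Φ i '' (B' i).truncTimeSlab (3 * M i) 0) m) →
      𝒟.BondiBartnikGapLE ({p} ∪ ⋃ i, Φ i '' (B' i).truncTimeSlab (3 * M i) 0) γ →
      ∃ S' : Set 𝒟.carrier, 𝒟.toCauchyDevelopment.IsNearKerrLeaf k ε 1 M a S' ∧
      S' ⊆ 𝒟.metric.causalFuture 𝒟.timeOrientation S) :
    BondiBartnikRigidityRepaired := by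
  intro χ m₀ N₀ k ε hχ hm₀ hε
  obtain ⟨k₁, hP⟩ := hB2 k ε hε
  obtain ⟨k₄, hW⟩ := hF3 k₁
  obtain ⟨k₆, hC⟩ := hCo χ m₀ k ε hχ hm₀ hε
  set k' : ℕ := max k (max k₄ k₆) with hk'
  have hkk' : k ≤ k' := by omega
  have hk₄ : k₄ ≤ k' := by omega
  have hk₆ : k₆ ≤ k' := by omega
  refine ⟨k', fun Λ hΛ1 => ?_⟩
  by_cases hΛε : Λ ≤ ε
  · refine ⟨1, 1, one_pos, one_pos, ?_⟩
    intro X _ _ _ _ _ _ D hD 𝒟 N M a S p mo' B' Φ hmax hN hN1 hwin hleaf hp hpc hB hΦ hdev hsub hdis hcut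
      hgap
    exact Summit.FinalStateConjecture.FinalStateConjecture.Theorems.stub_trivialRegime k k' ε Λ hkk'
      hΛε X D 𝒟 N M a S hleaf
  · have hεΛ : ε < Λ := lt_of_not_ge hΛε
    obtain ⟨Λ₁, γ₄, hΛ₁, hγ₄, hW'⟩ := hW Λ hΛ1
    obtain ⟨γ₅, hγ₅, hP'⟩ := hP Λ₁ hΛ₁
    obtain ⟨δ₆, γ₆, hδ₆, hγ₆, hC'⟩ := hC Λ hΛ1 hεΛ
    set γs : ℝ := min (min γ₄ γ₅) γ₆ with hγs
    have hγs0 : 0 < γs := lt_min (lt_min hγ₄ hγ₅) hγ₆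
    have hγs₄ : γs ≤ γ₄ := (min_le_left _ _).trans (min_le_left _ _)
    have hγs₅ : γs ≤ γ₅ := (min_le_left _ _).trans (min_le_right _ _)
    have hγs₆ : γs ≤ γ₆ := min_le_right _ _
    refine ⟨δ₆, γs / 3, hδ₆, by positivity, ?_⟩
    intro X _ _ _ _ _ _ D hD 𝒟 N M a S p mo' B' Φ hmax hN hN1 hwin hleaf hp hpc hB hΦ hdev hsub hdis hcut
      hgap
    have hgap' : 𝒟.BondiBartnikGapLE ({p} ∪ ⋃ i, Φ i '' (B' i).truncTimeSlab (3 * M i) 0)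
        (γs / 3) := hgap
    have hγ3₆ : γs / 3 ≤ γ₆ := by linarith
    rcases N with _ | _ | n
    · -- N = 0: the line
      have hC0 : ({p} ∪ ⋃ i, Φ i '' (B' i).truncTimeSlab (3 * M i) 0) = ({p} : Set 𝒟.carrier) := by
        simp
      rw [hC0] at hgap'
      obtain ⟨m', hm', hm'le⟩ := hB1 X D hD 𝒟 p hmax (hleaf.subset_causalFuture hp) (γs / 3)
        (by positivity)
      obtain ⟨m, hm, hmle⟩ :=
        (VacuumCauchyDevelopment.bondiBartnikGapLE_iff.1 hgap') m' hm' (γs / 3) (by positivity)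
      have hmγ : m ≤ γs := by linarith
      obtain ⟨S₁, hS₁, hS₁p⟩ :=
        hW' X D hD 𝒟 M a S p m hmax (hleaf.mono hk₄ le_rfl) hp hm (hmγ.trans hγs₄)
      obtain ⟨S', hS', hS'S₁⟩ := hP' X D hD 𝒟 M a S₁ p m hmax hS₁ hS₁p hm (hmγ.trans hγs₅)
      refine ⟨S', hS', hS'S₁.trans ((LorentzianMetric.causalFuture_mono hS₁p).trans ?_)⟩
      rw [LorentzianMetric.causalFuture_causalFuture_eq (WithTop.coe_le_coe.mpr le_top)
        ({p} : Set 𝒟.carrier)]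
      exact LorentzianMetric.causalFuture_mono (singleton_subset_iff.2 hp)
    · -- N = 1: p is in the collar by the C″ clause
      have hpc' : ∃ i, p ∈ Φ i '' (B' i).truncTimeSlab (3 * M i) 0 := by
        rcases hpc with h0 | h1
        · exact absurd h0 (by omega)
        · exact h1
      exact hC' X D hD 𝒟 M a S p mo' B' Φ hmax hwin (hleaf.mono hk₆ le_rfl) hp hpc' hB hΦ
        (fun i => (supCkENorm_mono_right _ hk₆ _).trans (hdev i)) hsub hcut (hgap'.mono hγ3₆)
    · -- N ≥ 2 is excluded
      exact absurd hN1 (by omega)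

end Summit.FinalStateConjecture.FinalStateConjecture.Cruxes.BondiBartnikRigidity.HyperboloidalMassPinchesFlat.Port

end
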